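import Mathlib.Data.Countable.Basic
import Literature.AlgebraicGeometry.Frobenioids.PiNatMonoid
import Literature.AlgebraicGeometry.Frobenioids.MonoidTransport
import Literature.AlgebraicGeometry.Frobenioids.PerfFactorialWeak
import Literature.AlgebraicGeometry.Frobenioids.PerfectionDivisorial

/-!
# Countability of the primes of `M^pf` (the hypothesis of the "no phantom support" theorem)

Mochizuki, *The geometry of Frobenioids I*, Kyushu J. Math. **62** (2008), §0, kurims p.12
[cite: MochizukiFrdI2008, §0 p.12] ("the natural map `M → M^pf` induces a bijection `Prime(M) ⥲ Prime(M^pf)`");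
*The étale theta function …*, Publ. RIMS **45** (2009), Def. 3.1 (i) / Prop. 3.2 (i) pp.70–71
[cite: MochizukiEtTh2009, Prop 3.2 p.70] (log-divisors supported on the special fibre — irreducible
components indexed by `ℤ` for the universal combinatorial covering of a Tate curve — and the cusps).

abc-iut cell, seat abc-iut-L2-d2: small bookkeeping for the countability hypothesis
`Countable (Primes (Perfection P))` of `NoPhantomSupport.lean` ((R3) of [EtTh] Cor. 3.8 (iii) for
countably many primes): it reduces to `Countable (Primes P)` for sharp `P` (in particular for every
(weakly) perf-factorial `P`), transports along `≃*`, and holds for the model `∏_J ℤ≥0` with `J` countable.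
Theorems only.  HONEST FRAMING: nothing here bears on [IUTchIII] Cor. 3.12.
-/

namespace Literature.AlgebraicGeometry.Frobenioids

open Function

universe u

/-- For sharp `M`, `Prime(M^pf)` is countable iff `Prime(M)` is (`Prime(M) ≃ Prime(M^pf)`, §0 p.12).
[cite: MochizukiFrdI2008, §0 p.12] -/
theorem countable_primes_perfection_iff {M : Type u} [CommMonoid M] (hM : IsSharp M) :
    Countable (Primes (Perfection M)) ↔ Countable (Primes M) := by
  obtain ⟨e, -⟩ := primes_equiv_primes_perfection hM
  exact ⟨fun _ => Countable.of_equiv _ e.symm, fun _ => Countable.of_equiv _ e⟩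

/-- For a weakly perf-factorial `M` (hence sharp), `Prime(M^pf)` is countable as soon as `Prime(M)` is.
[cite: MochizukiFrdI2008, §0 p.12] -/
theorem IsPerfFactorialWeak.countable_primes_perfection {M : Type u} [CommMonoid M]
    (h : IsPerfFactorialWeak M) [Countable (Primes M)] : Countable (Primes (Perfection M)) :=
  (countable_primes_perfection_iff h.isDivisorial.isSharp).mpr ‹_›

/-- Countability of `Prime(M)` transports along `M ≃* M'`. [cite: MochizukiFrdI2008, §0 p.12] -/
theorem countable_primes_of_mulEquiv {M M' : Type u} [CommMonoid M] [CommMonoid M'] (e : M ≃* M')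
    [Countable (Primes M)] : Countable (Primes M') :=
  Countable.of_equiv _ (Primes.congr e)

/-- **The model `∏_J ℤ≥0` (the shape of `DIV⁺(Z_∞^log)`, [EtTh] Prop. 3.2 (i)) has countably many primes
when `J` is countable** (its primes are the coordinates, `PiNat.primesEquiv`): e.g. `J = ℤ ⊔ cusps`.
[cite: MochizukiEtTh2009, Prop 3.2 p.70] -/
theorem PiNat.countable_primes (J : Type u) [DecidableEq J] [Countable J] :
    Countable (Primes (Multiplicative (J → ℕ))) :=
  Countable.of_equiv _ (PiNat.primesEquiv (J := J))

/-- … and so does its perfection. [cite: MochizukiEtTh2009, Prop 3.2 p.70] -/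
theorem PiNat.countable_primes_perfection (J : Type u) [DecidableEq J] [Countable J] :
    Countable (Primes (Perfection (Multiplicative (J → ℕ)))) :=
  (countable_primes_perfection_iff PiNat.isSharp).mpr (PiNat.countable_primes J)

end Literature.AlgebraicGeometry.Frobenioids
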